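import Mathlib
import HarnessLib
import Summits.NavierStokesRegularity.NavierStokesRegularity.Theorems.CompletionRelayChainPhaseISoundDelta
import Summits.NavierStokesRegularity.NavierStokesRegularity.Theorems.CompletionRelayChainPhaseIStepHist

/-!
# Route `CompletionRelayChain` — crux `RelayFrontStep` (stmt-NavierStokesRegularity-24850), K-side of `stub_phaseI`,
  work package K5-f: THE NODE INVARIANT AND ITS PROPAGATION THROUGH ONE CHECKER STEP

`NodeInv θ m st`: the node-`m` Taylor models contain the extended block state at time `m·h` (at the flow's own
parameter point `θ`), the Riemann sums dominate `∫u₂²`, `∫|r₂u₂|`, the running maxima dominate the past amplitudes and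
the envelope facts hold on `[0, m·h]`.  `nodeInv_step`: if the step's tests pass (`(step st).ok`), the invariant holds at
node `m+1` for `(step st).next` — by `abs_pseudo_sub_taylor_le_hist` (p626834) fed with `dist_le_delta`, `mem_fieldIV`,
`abs_jet6_le`, `abs_fieldR_sub_le`, and the Taylor-model containment `contains_jetTM`.
MODEL-lattice bookkeeping (rung TL-M3-R64); nothing here is a statement about the Navier–Stokes equations.
-/

noncomputable section

set_option linter.dupNamespace false

namespace Summit.NavierStokesRegularity.NavierStokesRegularity.Cruxes.RelayFrontStep.PhaseI

open Set Checker MeasureTheory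
open Literature.Analysis.FluidPDE.TaoCascade
open Summit.NavierStokesRegularity.NavierStokesRegularity.Theorems.TaylorModelReadout (taylorJet taylorJet_zero
  taylorJet_succ_apply)

variable {α : Fin 4 → Fin 4 → Fin 4 → ℤ × ℤ × ℤ → ℝ} {τ : ℝ} {S₀ F₀ B₀ : Fin 4 → ℤ → ℝ} {S F : Fin 4 → ℤ → ℝ → ℝ}

/-! ### The envelope facts and the node invariant -/

/-- The envelope facts at time `s`: the conjuncts of `PhaseIEnvelope` and `F ≤ relayEnv₂` on old shells `0,1,2`.
[this file] -/
def EnvAt (S F : Fin 4 → ℤ → ℝ → ℝ) (s : ℝ) : Prop :=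
  ((-(17/500) : ℝ) ≤ S 0 0 s ∧ ((9/25 : ℝ) ≤ S 1 0 s ∧ S 1 0 s ≤ (87/100 : ℝ)) ∧
    ((-(3/1000000) : ℝ) ≤ S 2 0 s ∧ S 2 0 s ≤ (3/100 : ℝ)) ∧ ((-(1/10000000) : ℝ) ≤ S 0 1 s ∧ S 0 1 s ≤ (28/25 : ℝ)) ∧
    ((-(1/1000000) : ℝ) ≤ S 1 1 s ∧ S 1 1 s ≤ (4/25 : ℝ)) ∧ ((-(1/100000) : ℝ) ≤ S 2 1 s ∧ S 2 1 s ≤ (3/100000 : ℝ)) ∧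
    ((-(1/500) : ℝ) ≤ S 0 2 s ∧ S 0 2 s ≤ (3/250 : ℝ)) ∧ ((-(1/10000000) : ℝ) ≤ S 1 2 s ∧ S 1 2 s ≤ (1/10000000 : ℝ)) ∧
    ((-(1/500000000) : ℝ) ≤ S 2 2 s ∧ S 2 2 s ≤ (1/500000000 : ℝ)) ∧
    |S 0 (-1) s| ≤ (43/50 : ℝ) ∧ |S 1 (-1) s| ≤ (77/100 : ℝ) ∧ |S 2 (-1) s| ≤ (18/25 : ℝ)) ∧
  ∀ (i : Fin 4) (k : ℤ), 0 ≤ k → k ≤ 2 → i ≠ 3 → F i k s ≤ Window2.relayEnv₂ k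

/-- THE NODE INVARIANT at node `m` for checker state `st` and parameter point `θ`. [this file] -/
def NodeInv (S F : Fin 4 → ℤ → ℝ → ℝ) (θ : Fin 7 → ℝ) (m : ℕ) (st : State) : Prop :=
  (∀ c : Fin 19, TM.Contains (st.T[c]) θ (zc S ((m : ℝ) * hR) c)) ∧
  (∫ s in (0:ℝ)..((m : ℝ) * hR), S 1 2 s ^ 2) ≤ (st.I1 : ℝ) ∧
  (∫ s in (0:ℝ)..((m : ℝ) * hR), |S 2 2 s * S 1 2 s|) ≤ (st.I2 : ℝ) ∧
  (0 < m → ∀ r ∈ Icc (0:ℝ) ((m : ℝ) * hR), ∀ c : Fin 19, |zc S r c| ≤ ((st.emax[c] : ℚ) : ℝ)) ∧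
  (0 < m → ∀ r ∈ Icc (0:ℝ) ((m : ℝ) * hR), EnvAt S F r)

/-! ### Unfolding `step` -/

/-- The a priori box of `step`. [this file] -/
def sBox (st : State) : V19 IV := boxGuess (rangeIV st.T) st.emax
/-- The magnitudes of the box. [this file] -/
def sMag (st : State) : V19 ℚ := Vector.ofFn fun c => ((sBox st)[c]).mag
/-- `Δ` of `step`. [this file] -/
def sD (st : State) : V19 ℚ := delta (sBox st) st.emax
/-- The bootstrap vector of `step`. [this file] -/
def sBv (st : State) : V19 ℚ := bSearch (sMag st) (sD st) 6 (Vector.ofFn fun c => 2 * Checker.h * (sD st)[c])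
/-- The Lagrange bounds of `step`. [this file] -/
def sLag (st : State) : V19 ℚ :=
  Vector.ofFn fun c => ((agetV (jetLevelsV ivOpsP coefsQ (sBox st) 6) 6 (sBox st))[c]).mag * hPow 6

set_option maxHeartbeats 4000000 in
/-- The tests behind `(step st).ok = true`. [this file] -/
theorem step_ok (st : State) (h : (step st).ok = true) :
    boxTest (rangeIV st.T) (sBox st) st.emax = true ∧
      (st.I1 + Checker.h * ((sMag st)[cix 5 1] * (sMag st)[cix 5 1]) ≤ 1 / 10 ^ 11 ∧
        st.I2 + Checker.h * ((sMag st)[cix 5 1] * (sMag st)[cix 5 2]) ≤ 1 / 10 ^ 13) ∧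
      envTest (sBox st) = true ∧ relayEnvTest (sBox st) = true ∧ bTest (sMag st) (sD st) (sBv st) = true := by
  rw [step] at h
  simp only [Bool.and_eq_true, decide_eq_true_eq] at h
  obtain ⟨⟨⟨⟨h1, h2⟩, h3⟩, h4⟩, h5⟩ := h
  exact ⟨h1, h2, h3, h4, h5⟩

set_option maxHeartbeats 4000000 in
/-- `(step st).next.I1` unfolded. [this file] -/
theorem step_I1 (st : State) : (step st).next.I1 = st.I1 + Checker.h * ((sMag st)[cix 5 1] * (sMag st)[cix 5 1]) := rfl
set_option maxHeartbeats 4000000 in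
/-- `(step st).next.I2` unfolded. [this file] -/
theorem step_I2 (st : State) : (step st).next.I2 = st.I2 + Checker.h * ((sMag st)[cix 5 1] * (sMag st)[cix 5 2]) := rfl
set_option maxHeartbeats 4000000 in
/-- `(step st).next.emax` unfolded. [this file] -/
theorem step_emax (st : State) (c : Fin 19) : (step st).next.emax[c] = max (st.emax[c]) ((sMag st)[c]) := by
  show (Vector.ofFn fun c => max (st.emax[c]) ((sMag st)[c]))[c] = _
  simp [Fin.getElem_fin, Vector.getElem_ofFn]
set_option maxHeartbeats 4000000 in
/-- `(step st).next.T` unfolded. [this file] -/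
theorem step_T (st : State) (c : Fin 19) : (step st).next.T[c] =
    (if c.val = 18 then TM.const 1 0 else
      tmStep (st.T[c]) ((agetV (jetLevelsV tmOps coefsQ st.T 5) 1 st.T)[c])
        ((agetV (jetLevelsV tmOps coefsQ st.T 5) 2 st.T)[c]) ((agetV (jetLevelsV tmOps coefsQ st.T 5) 3 st.T)[c])
        ((agetV (jetLevelsV tmOps coefsQ st.T 5) 4 st.T)[c]) ((agetV (jetLevelsV tmOps coefsQ st.T 5) 5 st.T)[c])
        ((sLag st)[c] + (sBv st)[c])) := by
  show (Vector.ofFn fun c : Fin 19 => if c.val = 18 then TM.const 1 0 else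
      tmStep (st.T[c]) ((agetV (jetLevelsV tmOps coefsQ st.T 5) 1 st.T)[c])
        ((agetV (jetLevelsV tmOps coefsQ st.T 5) 2 st.T)[c]) ((agetV (jetLevelsV tmOps coefsQ st.T 5) 3 st.T)[c])
        ((agetV (jetLevelsV tmOps coefsQ st.T 5) 4 st.T)[c]) ((agetV (jetLevelsV tmOps coefsQ st.T 5) 5 st.T)[c])
        ((sLag st)[c] + (sBv st)[c]))[c] = _
  simp only [Fin.getElem_fin, Vector.getElem_ofFn]

/-! ### The derivative of the extended block curve on a step -/

/-- The extended block curve on `[a, a+h]` has velocity `zv` within `[0,h]` after translation. [this file] -/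
theorem hasDerivWithinAt_zc (H : Hyps α τ S₀ F₀ B₀ S F) {a : ℝ} (ha : 0 ≤ a) (hah : a + hR ≤ τ) :
    ∀ σ ∈ Icc (0:ℝ) hR, HasDerivWithinAt (fun s => zc S (a + s)) (zv S τ (a + σ)) (Icc 0 hR) σ := by
  intro σ hσ
  have hb := (blockStep H.hflow H.hrows ha hah).1 σ hσ
  refine hasDerivWithinAt_pi.2 fun c => ?_
  by_cases hc : c.val < 18
  · have hcomp := (hasDerivWithinAt_pi.1 hb) (dec c hc)
    have e1 : (fun s => zc S (a + s) c) = fun s => blockState S (a + s) (dec c hc) := by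
      funext s
      have h1 := zc_enc S (a + s) (dec c hc)
      rw [enc_dec] at h1
      rw [h1]; rfl
    have e2 : zv S τ (a + σ) c = blockVel S τ (a + σ) (dec c hc) := by simp only [zv, dif_pos hc]
    rw [e1, e2]; exact hcomp
  · have hc18 : c = (18 : Fin 19) := by apply Fin.ext; have := c.isLt; simp; omega
    subst hc18
    have e1 : (fun s => zc S (a + s) (18 : Fin 19)) = fun _ => (1 : ℝ) := by funext s; exact zc_last S _
    have e2 : zv S τ (a + σ) (18 : Fin 19) = 0 := by simp [zv]
    rw [e1, e2]; exact hasDerivWithinAt_const _ _ _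

/-! ### The Taylor-model step contains the new state -/

/-- The six-term Taylor sum. [this file] -/
theorem sum_range_six (f : ℕ → ℝ) : ∑ k ∈ Finset.range 6, f k = f 0 + f 1 + f 2 + f 3 + f 4 + f 5 := by
  simp [Finset.sum_range_succ]

/-- **`tmStep` contains the point `x₀ + h x₁ + … + h⁵ x₅ + e'` with `|e'| ≤ e`.** [this file] -/
theorem contains_tmStep {θ : Fin 7 → ℝ} (hθ : TM.InBox θ) {Y0 Y1 Y2 Y3 Y4 Y5 : TM 7} {x : ℕ → ℝ}
    (h0 : Y0.Contains θ (x 0)) (h1 : Y1.Contains θ (x 1)) (h2 : Y2.Contains θ (x 2)) (h3 : Y3.Contains θ (x 3))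
    (h4 : Y4.Contains θ (x 4)) (h5 : Y5.Contains θ (x 5)) {e : ℚ} {y : ℝ}
    (hy : |y - ∑ k ∈ Finset.range 6, x k * hR ^ k| ≤ (e : ℝ)) :
    (tmStep Y0 Y1 Y2 Y3 Y4 Y5 e).Contains θ y := by
  unfold tmStep
  refine TM.contains_round P hθ (TM.contains_addRem ?_ hy)
  have hp : ∀ j, ((hPow j : ℚ) : ℝ) = hR ^ j := fun j => by simp [hPow, Checker.h, hR]
  have e : ∑ k ∈ Finset.range 6, x k * hR ^ k =
      x 0 + (hPow 1 : ℚ) * x 1 + (hPow 2 : ℚ) * x 2 + (hPow 3 : ℚ) * x 3 + (hPow 4 : ℚ) * x 4 + (hPow 5 : ℚ) * x 5 := by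
    rw [sum_range_six]; simp only [hp]; ring
  rw [e]
  exact TM.contains_add (TM.contains_add (TM.contains_add (TM.contains_add (TM.contains_add h0
    (TM.contains_smul _ h1)) (TM.contains_smul _ h2)) (TM.contains_smul _ h3)) (TM.contains_smul _ h4))
    (TM.contains_smul _ h5)

/-! ### Propagation of the invariant -/

set_option maxHeartbeats 400000 in
/-- `EnvAt` from the envelope tests on a box containing the block state. [this file] -/
theorem envAt_of_tests (H : Hyps α τ S₀ F₀ B₀ S F) {B : V19 IV} (henv : envTest B = true) (hrel : relayEnvTest B = true)
    {t : ℝ} (ht0 : 0 ≤ t) (htT : t ≤ 147 / 64) (hbox : InBoxR B (zc S t)) : EnvAt S F t := by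
  have hv := of_decide_eq_true henv
  have hr := of_decide_eq_true hrel
  have hb : ∀ c : Fin 19, (((B[c]).lo : ℚ) : ℝ) ≤ zc S t c ∧ zc S t c ≤ (((B[c]).hi : ℚ) : ℝ) := fun c => hbox c
  have hm : ∀ c : Fin 19, |zc S t c| ≤ (((B[c]).mag : ℚ) : ℝ) := fun c => abs_le_mag_of_inBoxR hbox c
  obtain ⟨z30, z31, z32, z40, z41, z42, z50, z51, z52, z20, z21, z22⟩ := zc_table S t
  obtain ⟨e00, e10l, e10u, e20l, e20u, e01l, e01u, e11l, e11u, e21l, e21u, e02l, e02u, e12l, e12u, e22l, e22u,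
    em1, em2, em3⟩ := hv
  refine ⟨?_, ?_⟩
  · have m30 := hb (cix 3 0); have m31 := hb (cix 3 1); have m32 := hb (cix 3 2)
    have m40 := hb (cix 4 0); have m41 := hb (cix 4 1); have m42 := hb (cix 4 2)
    have m50 := hb (cix 5 0); have m51 := hb (cix 5 1); have m52 := hb (cix 5 2)
    have g20 := hm (cix 2 0); have g21 := hm (cix 2 1); have g22 := hm (cix 2 2)
    rw [z30] at m30; rw [z31] at m31; rw [z32] at m32; rw [z40] at m40; rw [z41] at m41; rw [z42] at m42
    rw [z50] at m50; rw [z51] at m51; rw [z52] at m52; rw [z20] at g20; rw [z21] at g21; rw [z22] at g22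
    have c00 := (Rat.cast_le (K := ℝ)).2 e00
    have c10l := (Rat.cast_le (K := ℝ)).2 e10l; have c10u := (Rat.cast_le (K := ℝ)).2 e10u
    have c20l := (Rat.cast_le (K := ℝ)).2 e20l; have c20u := (Rat.cast_le (K := ℝ)).2 e20u
    have c01l := (Rat.cast_le (K := ℝ)).2 e01l; have c01u := (Rat.cast_le (K := ℝ)).2 e01u
    have c11l := (Rat.cast_le (K := ℝ)).2 e11l; have c11u := (Rat.cast_le (K := ℝ)).2 e11u
    have c21l := (Rat.cast_le (K := ℝ)).2 e21l; have c21u := (Rat.cast_le (K := ℝ)).2 e21u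
    have c02l := (Rat.cast_le (K := ℝ)).2 e02l; have c02u := (Rat.cast_le (K := ℝ)).2 e02u
    have c12l := (Rat.cast_le (K := ℝ)).2 e12l; have c12u := (Rat.cast_le (K := ℝ)).2 e12u
    have c22l := (Rat.cast_le (K := ℝ)).2 e22l; have c22u := (Rat.cast_le (K := ℝ)).2 e22u
    have cm1 := (Rat.cast_le (K := ℝ)).2 em1; have cm2 := (Rat.cast_le (K := ℝ)).2 em2
    have cm3 := (Rat.cast_le (K := ℝ)).2 em3
    push_cast at c00 c10l c10u c20l c20u c01l c01u c11l c11u c21l c21u c02l c02u c12l c12u c22l c22u cm1 cm2 cm3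
    refine ⟨by linarith [m30.1], ⟨by linarith [m31.1], by linarith [m31.2]⟩, ⟨by linarith [m32.1], by linarith [m32.2]⟩,
      ⟨by linarith [m40.1], by linarith [m40.2]⟩, ⟨by linarith [m41.1], by linarith [m41.2]⟩,
      ⟨by linarith [m42.1], by linarith [m42.2]⟩, ⟨by linarith [m50.1], by linarith [m50.2]⟩,
      ⟨by linarith [m51.1], by linarith [m51.2]⟩, ⟨by linarith [m52.1], by linarith [m52.2]⟩,
      g20.trans cm1, g21.trans cm2, g22.trans cm3⟩
  · intro i k hk0 hk2 hi3
    -- i ≠ 3 is a block mode; k ∈ {0,1,2} is slot k+3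
    obtain ⟨j, rfl⟩ : ∃ j : Fin 3, blockMode j = i := by
      fin_cases i
      · exact ⟨0, rfl⟩
      · exact ⟨1, rfl⟩
      · exact ⟨2, rfl⟩
      · exact absurd rfl hi3
    obtain ⟨s, hs, rfl⟩ : ∃ s : Fin 6, 3 ≤ s.val ∧ (((s : ℕ) : ℤ) - 3) = k := by
      refine ⟨⟨(k + 3).toNat, by omega⟩, by simp; omega, by simp; omega⟩
    have hmag : |S (blockMode j) (((s : ℕ) : ℤ) - 3) t| ≤ (((B[enc (s, j)]).mag : ℚ) : ℝ) := by
      rw [← zc_enc S t (s, j)]; exact abs_le_mag_of_inBoxR hbox _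
    have hF := energy_le_fslack H s j ht0 htT hmag
    have htest := hr (enc (s, j)) (by simp [enc]; omega) (enc_val_lt _)
    have hcast := (Rat.cast_le (K := ℝ)).2 htest
    refine hF.trans (hcast.trans (le_of_eq ?_))
    -- relayEnvQ = relayEnv₂
    rw [relayEnvQ, slot_enc, Window2.relayEnv₂, if_pos (by omega)]
    have hs6 := s.isLt
    interval_cases hsv : s.val <;> first | rfl | (push_cast; norm_num)

end Summit.NavierStokesRegularity.NavierStokesRegularity.Cruxes.RelayFrontStep.PhaseI

end
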